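import Mathlib.RingTheory.Localization.AtPrime.Basic
import Summits.ResolutionOfSingularities.ResolutionOfSingularities.Theorems.WeightedInvariantHypersurfaceLocalGameEFTCurveMoveChart
import Summits.ResolutionOfSingularities.ResolutionOfSingularities.Theorems.WeightedInvariantIotaOrder
import HarnessLib

/-!
# The e.f.t. local weighted game (H2a′), curve move II: the chart isomorphism `B_𝔫 ≅ S[X]_𝔮` off the vertex

Topic: `Summits/ResolutionOfSingularities/ResolutionOfSingularities/Theorems`. Helper (part 2 of 3) for the door item
`HypersurfaceCentreConstruction` (statement `stmt-ResolutionOfSingularities-19897`, route `WeightedInvariant`);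
kernel K2 of `L/res-type-098-w43/EFT-DIM2-DESIGN.md` (ORDER (o13) of `res-L1-w43-plan-1`).

[OURS · L1 W4.3] Replaces the role of NO printed item; NOT a statement of the manuscript
[claim: Hironaka2017, status: under-review]. AI work, weaker than expert review.

Content: the substitution `phi : S[X] → B = S[t⁻¹, πt]`, `X ↦ πt` (injective for `π ≠ 0` in a domain:
`coeff_phi`, `phi_injective`); for a prime `𝔫` of `B` NOT containing `πt` (= off the vertex) and `𝔮 = phi⁻¹𝔫`,
the induced local map `phiLoc : S[X]_𝔮 → B_𝔫` is bijective (`t⁻¹ = π·(πt)⁻¹` and `a tⁿ = c·(πt)ⁿ` give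
surjectivity: `algebraMap_mem_range_phiLoc`), whence the CHART ISOMORPHISM `chartEquiv : S[X]_𝔮 ≃+* B_𝔫`
(Włodarczyk Lemma 4.6.1, ring level) and, with res-type-073's `iotaOrd_torusFactor_eq` + `iotaOrd_isoInvariant`,
**`iotaOrd B_𝔫 f₂ = iotaOrd S f₂`** for every `f₂ ∈ S` when `𝔫 ⊇ 𝔪B` (`iotaOrd_algebraMap_eq`).

## References

* J. Włodarczyk, *Functorial resolution by torus actions*, arXiv:2203.03090, Lemma 4.6.1 (charts of `B₊`).
  [Wlodarczyk2022]
-/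

noncomputable section

open IsLocalRing Literature.AlgebraicGeometry.Resolution
open LaurentPolynomial
open scoped LaurentPolynomial
open Summit.ResolutionOfSingularities.ResolutionOfSingularities.Cruxes.HypersurfaceCentreConstruction.LocalEngine
  (iotaOrd iotaOrd_isoInvariant iotaOrd_unitInvariant iotaOrd_torusFactor_eq iotaOrd_eq_ordOfENat_adicOrder
    ordOfENat_strictMono)

set_option linter.dupNamespace false -- mandated namespace of this single-conjunct summit

namespace Summit.ResolutionOfSingularities.ResolutionOfSingularities.Theorems

namespace LocalGameEFTCurveMove

variable {S : Type} [CommRing S]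

/-! ## The chart isomorphism `B_𝔫 ≅ S[X]_𝔮` off the vertex -/

section Localization

variable (π : S)

/-- The substitution `X ↦ πt`: `S[X] → B = S[t⁻¹, πt]`. [folklore] -/
def phi : Polynomial S →ₐ[S] extReesAlgebra (weightedMonomialIdeal (fun _ : Fin 1 => π) (fun _ => 1)) :=
  Polynomial.aeval (piT π)

/-- `phi (C s) = s`. [folklore] -/
@[simp] theorem phi_C (s : S) : phi π (Polynomial.C s) = algebraMap S _ s := by
  simp [phi]

/-- `phi X = πt`. [folklore] -/
@[simp] theorem phi_X : phi π Polynomial.X = piT π := by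
  simp [phi]

/-- The Laurent coefficients of `phi p`: `(phi p)_i = πⁱ · pᵢ` for `i ≥ 0`. [folklore] -/
theorem coeff_phi (p : Polynomial S) (i : ℕ) :
    ((phi π p : extReesAlgebra (weightedMonomialIdeal (fun _ : Fin 1 => π) (fun _ => 1))) :
      S[T;T⁻¹]).coeff (i : ℤ) = π ^ i * p.coeff i := by
  have key : ((phi π p : extReesAlgebra _) : S[T;T⁻¹]) =
      ∑ j ∈ Finset.range (p.natDegree + 1), AddMonoidAlgebra.single (j : ℤ) (π ^ j * p.coeff j) := by
    conv_lhs => rw [phi, Polynomial.aeval_eq_sum_range]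
    rw [AddSubmonoidClass.coe_finsetSum]
    refine Finset.sum_congr rfl fun j _ => ?_
    rw [Subalgebra.coe_smul, SubmonoidClass.coe_pow, coe_piT, mul_pow, ← map_pow, T_pow, Algebra.smul_def,
      ← C_eq_algebraMap, ← mul_assoc, ← map_mul, single_eq_C_mul_T, mul_comm (p.coeff j)]
    congr 2
    push_cast
    ring
  rw [key, AddMonoidAlgebra.coeff_sum, Finset.sum_apply']
  simp_rw [AddMonoidAlgebra.coeff_single]
  rw [Finset.sum_eq_single i]
  · rw [Finsupp.single_eq_same]
  · intro j _ hj
    exact Finsupp.single_eq_of_ne (by exact_mod_cast hj.symm)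
  · intro hi
    rw [Finset.mem_range, not_lt] at hi
    rw [Polynomial.coeff_eq_zero_of_natDegree_lt (by omega), mul_zero, Finsupp.single_zero,
      Finsupp.zero_apply]

variable {π}

/-- `phi` is injective (`π ≠ 0`, `S` a domain). [folklore] -/
theorem phi_injective [IsDomain S] (hπ0 : π ≠ 0) : Function.Injective (phi π) := by
  rw [injective_iff_map_eq_zero]
  intro p hp
  ext i
  have h := coeff_phi π p i
  rw [hp, ZeroMemClass.coe_zero, AddMonoidAlgebra.coeff_zero, Finsupp.zero_apply] at h
  exact (mul_eq_zero.mp h.symm).resolve_left (pow_ne_zero i hπ0)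

variable (π)
variable (𝔫 : Ideal (extReesAlgebra (weightedMonomialIdeal (fun _ : Fin 1 => π) (fun _ => 1))))

/-- The ideal `𝔮 = phi⁻¹(𝔫)` of `S[X]` (an `abbrev`, so that `𝔮.IsPrime` is found by instance search from
Mathlib's `Ideal.IsPrime.comap`). [folklore] -/
abbrev qOf : Ideal (Polynomial S) := 𝔫.comap (phi π).toRingHom

variable {𝔫} in
/-- `X ∉ 𝔮` when `πt ∉ 𝔫`. [folklore] -/
theorem X_not_mem_qOf (hT : piT π ∉ 𝔫) : (Polynomial.X : Polynomial S) ∉ qOf π 𝔫 := by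
  rwa [qOf, Ideal.mem_comap, AlgHom.toRingHom_eq_coe, RingHom.coe_coe, phi_X]

variable [𝔫.IsPrime]

/-- `𝔮` is prime. [folklore] -/
theorem qOf_isPrime : (qOf π 𝔫).IsPrime := inferInstance

/-- `𝔮 ∩ S = 𝔪` when `𝔫 ⊇ 𝔪B` (`S` local). [folklore] -/
theorem comap_C_qOf [IsLocalRing S]
    (h𝔫 : (maximalIdeal S).map (algebraMap S
      (extReesAlgebra (weightedMonomialIdeal (fun _ : Fin 1 => π) (fun _ => 1)))) ≤ 𝔫) :
    (qOf π 𝔫).comap (Polynomial.C : S →+* Polynomial S) = maximalIdeal S := by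
  have hne : (qOf π 𝔫).comap (Polynomial.C : S →+* Polynomial S) ≠ ⊤ := by
    rw [Ne, Ideal.comap_eq_top_iff]
    exact (qOf_isPrime π 𝔫).ne_top
  refine le_antisymm (IsLocalRing.le_maximalIdeal hne) fun s hs => ?_
  rw [Ideal.mem_comap, qOf, Ideal.mem_comap, AlgHom.toRingHom_eq_coe, RingHom.coe_coe, phi_C]
  exact h𝔫 (Ideal.mem_map_of_mem _ hs)

/-- The chart map `S[X]_𝔮 → B_𝔫` induced by `phi`. [folklore] -/
def phiLoc : Localization.AtPrime (qOf π 𝔫) →+* Localization.AtPrime 𝔫 :=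
  Localization.localRingHom (qOf π 𝔫) 𝔫 (phi π).toRingHom rfl

/-- `phiLoc` on numerators. [folklore] -/
theorem phiLoc_algebraMap (p : Polynomial S) :
    phiLoc π 𝔫 (algebraMap (Polynomial S) (Localization.AtPrime (qOf π 𝔫)) p) =
      algebraMap _ (Localization.AtPrime 𝔫) (phi π p) :=
  Localization.localRingHom_to_map _ _ _ _ p

variable {𝔫}

/-- `phiLoc` is injective (`π ≠ 0`, `S` a domain). [folklore] -/
theorem phiLoc_injective [IsDomain S] (hπ0 : π ≠ 0) : Function.Injective (phiLoc π 𝔫) := by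
  rw [injective_iff_map_eq_zero]
  intro x hx
  obtain ⟨⟨p, s⟩, rfl⟩ := IsLocalization.mk'_surjective (qOf π 𝔫).primeCompl x
  dsimp only at hx ⊢
  rw [phiLoc, Localization.localRingHom_mk', IsLocalization.mk'_eq_zero_iff] at hx
  obtain ⟨c, hc⟩ := hx
  have hc0 : (c : extReesAlgebra (weightedMonomialIdeal (fun _ : Fin 1 => π) (fun _ => 1))) ≠ 0 :=
    fun h => c.2 (h ▸ 𝔫.zero_mem)
  have hp : phi π p = 0 := by
    rcases mul_eq_zero.mp hc with h | h
    · exact absurd h hc0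
    · exact h
  rw [(injective_iff_map_eq_zero _).mp (phi_injective hπ0) p hp, IsLocalization.mk'_zero]

/-- Every element of `B` lands in the range of `phiLoc` (generators: `s ∈ S`, `t⁻¹ = π · (πt)⁻¹`, and
`a tⁿ = c · (πt)ⁿ` for `a = c πⁿ ∈ 𝒥ₙ`). [folklore] -/
theorem algebraMap_mem_range_phiLoc (hT : piT π ∉ 𝔫)
    (b : extReesAlgebra (weightedMonomialIdeal (fun _ : Fin 1 => π) (fun _ => 1))) :
    algebraMap _ (Localization.AtPrime 𝔫) b ∈ (phiLoc π 𝔫).range := by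
  -- `X` is a unit of `S[X]_𝔮` and `phiLoc X = πt`
  have hXu : IsUnit (algebraMap (Polynomial S) (Localization.AtPrime (qOf π 𝔫)) Polynomial.X) :=
    IsLocalization.map_units _ (⟨Polynomial.X, X_not_mem_qOf π hT⟩ : (qOf π 𝔫).primeCompl)
  have e1 : algebraMap _ (Localization.AtPrime 𝔫) (piT π) =
      phiLoc π 𝔫 (algebraMap (Polynomial S) _ Polynomial.X) := by
    rw [phiLoc_algebraMap, phi_X]
  obtain ⟨b, hb⟩ := b
  suffices h : ∀ hb' : b ∈ extReesAlgebra (weightedMonomialIdeal (fun _ : Fin 1 => π) (fun _ => 1)),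
      algebraMap _ (Localization.AtPrime 𝔫)
        (⟨b, hb'⟩ : extReesAlgebra (weightedMonomialIdeal (fun _ : Fin 1 => π) (fun _ => 1))) ∈
        (phiLoc π 𝔫).range from h hb
  induction hb using Algebra.adjoin_induction with
  | mem x hx =>
    intro hx'
    rcases hx with rfl | ⟨n, hn, a, ha, rfl⟩
    · -- `t⁻¹ = π · (πt)⁻¹`
      refine ⟨algebraMap _ _ (Polynomial.C π) * ↑(hXu.unit⁻¹), ?_⟩
      have hTu : IsUnit (algebraMap _ (Localization.AtPrime 𝔫) (piT π)) :=
        IsLocalization.map_units _ (⟨piT π, hT⟩ : 𝔫.primeCompl)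
      refine (hTu.mul_left_inj).mp ?_
      rw [map_mul, mul_assoc]
      conv_lhs => rw [e1, ← map_mul, IsUnit.val_inv_mul, map_one, mul_one, phiLoc_algebraMap, phi_C]
      rw [← map_mul]
      congr 1
      exact algebraMap_pi_eq π
    · -- `a tⁿ = c (πt)ⁿ`
      have ha' : a ∈ Ideal.span {π ^ n} := by
        rw [← weightedMonomialIdeal_one_eq]; exact ha
      obtain ⟨c, rfl⟩ := Ideal.mem_span_singleton'.mp ha'
      refine ⟨algebraMap _ _ (Polynomial.C c * Polynomial.X ^ n), ?_⟩
      rw [phiLoc_algebraMap, map_mul, map_pow, phi_C, phi_X]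
      congr 1
      apply Subtype.ext
      rw [MulMemClass.coe_mul, SubmonoidClass.coe_pow, Subalgebra.coe_algebraMap, ← C_eq_algebraMap, coe_piT,
        mul_pow, ← map_pow, T_pow, ← mul_assoc, ← map_mul]
      congr 2
      push_cast
      ring
  | algebraMap r =>
    intro _
    refine ⟨algebraMap _ _ (Polynomial.C r), ?_⟩
    rw [phiLoc_algebraMap, phi_C]
    rfl
  | add x y hx hy ihx ihy =>
    intro h'
    have e : (⟨x + y, h'⟩ : extReesAlgebra (weightedMonomialIdeal (fun _ : Fin 1 => π) (fun _ => 1))) =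
        ⟨x, hx⟩ + ⟨y, hy⟩ := rfl
    rw [e, map_add]
    exact Subring.add_mem _ (ihx hx) (ihy hy)
  | mul x y hx hy ihx ihy =>
    intro h'
    have e : (⟨x * y, h'⟩ : extReesAlgebra (weightedMonomialIdeal (fun _ : Fin 1 => π) (fun _ => 1))) =
        ⟨x, hx⟩ * ⟨y, hy⟩ := rfl
    rw [e, map_mul]
    exact Subring.mul_mem _ (ihx hx) (ihy hy)

/-- `phiLoc` is surjective off the vertex. [folklore] -/
theorem phiLoc_surjective (hT : piT π ∉ 𝔫) : Function.Surjective (phiLoc π 𝔫) := by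
  intro z
  obtain ⟨⟨b, s⟩, rfl⟩ := IsLocalization.mk'_surjective 𝔫.primeCompl z
  obtain ⟨yb, hyb⟩ := algebraMap_mem_range_phiLoc π hT b
  obtain ⟨ys, hys⟩ := algebraMap_mem_range_phiLoc π hT
    (s : extReesAlgebra (weightedMonomialIdeal (fun _ : Fin 1 => π) (fun _ => 1)))
  have hsu : IsUnit (algebraMap _ (Localization.AtPrime 𝔫)
      (s : extReesAlgebra (weightedMonomialIdeal (fun _ : Fin 1 => π) (fun _ => 1)))) :=
    IsLocalization.map_units _ s
  haveI : IsLocalHom (phiLoc π 𝔫) := Localization.isLocalHom_localRingHom (qOf π 𝔫) 𝔫 (phi π).toRingHom rfl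
  have hysu : IsUnit ys := by
    refine isUnit_of_map_unit (phiLoc π 𝔫) ys ?_
    rw [hys]; exact hsu
  refine ⟨yb * ↑(hysu.unit⁻¹), ?_⟩
  dsimp only
  rw [IsLocalization.eq_mk'_iff_mul_eq, map_mul, hyb, mul_assoc, ← hys, ← map_mul, IsUnit.val_inv_mul,
    map_one, mul_one]

/-- **The chart isomorphism** `S[X]_𝔮 ≃ B_𝔫` at a prime `𝔫` of `B = S[t⁻¹, πt]` off the vertex
(`S` a domain, `π ≠ 0`). [cite: Wlodarczyk2022, Lemma 4.6.1] -/
def chartEquiv [IsDomain S] (hπ0 : π ≠ 0) (hT : piT π ∉ 𝔫) :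
    Localization.AtPrime (qOf π 𝔫) ≃+* Localization.AtPrime 𝔫 :=
  RingEquiv.ofBijective (phiLoc π 𝔫) ⟨phiLoc_injective π hπ0, phiLoc_surjective π hT⟩

/-- `chartEquiv` on numerators. [folklore] -/
theorem chartEquiv_algebraMap [IsDomain S] (hπ0 : π ≠ 0) (hT : piT π ∉ 𝔫) (p : Polynomial S) :
    chartEquiv π hπ0 hT (algebraMap (Polynomial S) (Localization.AtPrime (qOf π 𝔫)) p) =
      algebraMap _ (Localization.AtPrime 𝔫) (phi π p) :=
  phiLoc_algebraMap π 𝔫 p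

/-- **The order of an element of `S` is unchanged in `B_𝔫`** (off the vertex, `𝔫 ⊇ 𝔪B`):
`iotaOrd B_𝔫 f₂ = iotaOrd S f₂`. [folklore] -/
theorem iotaOrd_algebraMap_eq [IsDomain S] [IsLocalRing S] (hπ0 : π ≠ 0) (hT : piT π ∉ 𝔫)
    (h𝔫 : (maximalIdeal S).map (algebraMap S
      (extReesAlgebra (weightedMonomialIdeal (fun _ : Fin 1 => π) (fun _ => 1)))) ≤ 𝔫) (f₂ : S) :
    iotaOrd (Localization.AtPrime 𝔫) (algebraMap _ (Localization.AtPrime 𝔫) (algebraMap S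
      (extReesAlgebra (weightedMonomialIdeal (fun _ : Fin 1 => π) (fun _ => 1))) f₂)) = iotaOrd S f₂ := by
  have h1 := iotaOrd_isoInvariant (Localization.AtPrime (qOf π 𝔫)) (Localization.AtPrime 𝔫)
    (chartEquiv π hπ0 hT) (algebraMap (Polynomial S) _ (Polynomial.C f₂))
  rw [chartEquiv_algebraMap, phi_C] at h1
  rw [h1]
  exact iotaOrd_torusFactor_eq S f₂ (qOf π 𝔫) (comap_C_qOf π 𝔫 h𝔫)

end Localization

end LocalGameEFTCurveMove

end Summit.ResolutionOfSingularities.ResolutionOfSingularities.Theorems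

end
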